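import Summits.AnomalousDissipation.AnomalousDissipation.Theorems.SawtoothPulseCascadeK1LocalisedCascadePhaseWindowsCTG
import Summits.AnomalousDissipation.AnomalousDissipation.Theorems.SawtoothPulseCascadeK1LocalisedCascadeCTEJunkNumeric
import Summits.AnomalousDissipation.AnomalousDissipation.Theorems.SawtoothPulseCascadeK1LocalisedCascadeOscJunkNumeric
import Summits.AnomalousDissipation.AnomalousDissipation.Theorems.SawtoothPulseCascadeK1LocalisedCascadeLedgerFeedChain
import Summits.AnomalousDissipation.AnomalousDissipation.Theorems.SawtoothPulseCascadeK1LocalisedCascadeClassBlocksV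
import Summits.AnomalousDissipation.AnomalousDissipation.Theorems.SawtoothPulseCascadeK1LocalisedCascadeOscJunkBounds

set_option linter.dupNamespace false

/-!
# K1loc — PHASE 2 OF THE K1loc′ LEDGER (`800 → 4400 → 24000`) IN ALL-ORDERS CORNER-TRACE GRADE, AGAINST DECIMALS («CT-GEO»)

Prover lane on the crux `K1LocalisedCascade` (stmt-AnomalousDissipation-19491), route `SawtoothPulseCascade` (S-D fibre ledger,
corner-trace track; finding F-p1g9-1, memo v15: the all-orders corner-trace kernel has NO residue term, so the junk of a window is
carried by the first few blocks and both middle phases of the K1loc′ ledger close from the phase-1 data `E₂`, `o₂` alone).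
The four windows of `…PhaseWindowsCTG` at phase `j = 2` (`N₂ = 4`, `δ₂ ≤ 2⁻¹⁰²`): (T-H) `800 → 4400` and (S-V) `4400 → 24000` on
dyadic blocks, (O-V) above `24000` and (C-H) above `Y₂ = 2001` on blocks `⌊Λ₀(3/2)^m⌋`, each block sum evaluated by `norm_num`
(§1); the (C-H) feed is taken in the cone `|k₀| ≤ 4|k₁|` above `Y₂ ≥ 800`, i.e. INSIDE the off-cone set `O₂(800)`, so both feed caps
of `…LedgerFeedChain.strip_offCone_resolved_step` are the off-cone amplitude `o ≥ √O₂(800)` and no shell chain is needed (§0, §2):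
`S₃(24000) + O₃(24000) ≤ S₂(800) + O₂(800) + e₂(o)` and `√O₃(24000) ≤ W_O + W_C + o + 2·10⁻⁴` with
`(W_T, W_S, W_O, W_C) ≈ (0.0637, 0.0331, 0.0500, 0.0411)`.  No definitions; no statement about the crux.
[cite: Grafakos2014, Prop. 3.1.2 (5), Prop. 3.2.7 (3)] [problem: turb]
-/

namespace Summit.AnomalousDissipation.AnomalousDissipation.Theorems.SawtoothPulseCascade.K1Window

open MeasureTheory Set Filter Topology UnitAddTorus Function Complex Metric
open scoped Real ENNReal
open Literature.Analysis Literature.Analysis.FunctionSpaces Literature.Analysis.FunctionSpaces.Torus Literature.Analysis.FluidPDE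
open Literature.Analysis.FluidPDE.ShearStage
open Literature.Analysis.FluidPDE.SawtoothCascade Literature.Analysis.FluidPDE.SawtoothCascade.CascadeParams
open Summit.AnomalousDissipation.AnomalousDissipation.Theorems.SawtoothPulseCascade.K1Ledger.From

/-! ## §0 Monotonicity of the indicator energies in the indicator -/

/-- **Indicator energies are monotone in the indicator**: `p ⇒ q` pointwise gives `Σ'[p]‖ĝ‖² ≤ Σ'[q]‖ĝ‖²` for continuous `g`
(Parseval summability, `…TorusFourierCalculus.hasSum_sq_mFourierCoeff_of_continuous`). [cite: Grafakos2014, Prop. 3.2.7 (3)] -/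
theorem tsum_indicator_le_of_imp {p q : (Fin 2 → ℤ) → Prop} [DecidablePred p] [DecidablePred q] (hpq : ∀ k, p k → q k)
    {g : UnitAddTorus (Fin 2) → ℂ} (hg : Continuous g) :
    ∑' k : Fin 2 → ℤ, (if p k then (1 : ℝ) else 0) * ‖mFourierCoeff g k‖ ^ 2 ≤
      ∑' k : Fin 2 → ℤ, (if q k then (1 : ℝ) else 0) * ‖mFourierCoeff g k‖ ^ 2 := by
  have hs := (hasSum_sq_mFourierCoeff_of_continuous hg).summable
  have h1 : ∀ (r : (Fin 2 → ℤ) → Prop) [DecidablePred r],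
      Summable fun k => (if r k then (1 : ℝ) else 0) * ‖mFourierCoeff g k‖ ^ 2 := fun r _ =>
    hs.of_nonneg_of_le (fun k => mul_nonneg (by split_ifs <;> norm_num) (sq_nonneg _))
      (fun k => by split_ifs <;> nlinarith [sq_nonneg ‖mFourierCoeff g k‖])
  exact (h1 p).tsum_le_tsum (fun k => indicator_mul_le_of_imp (hpq k) (sq_nonneg _)) (h1 q)

section Cascade

variable (P : CascadeParams)

/-- **Continuity of the cascade iterates** `a_j` (as complex-valued functions). [folklore] -/
theorem continuous_iterate_ofReal {a : ℕ → UnitAddTorus (Fin 2) → ℝ} (has : ∀ j, IsSmooth (a j)) (j : ℕ) :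
    Continuous fun x => (a j x : ℂ) :=
  Complex.continuous_ofReal.comp (has j).continuous

/-- **The off-cone cap above a higher threshold**: `Y ≥ K` gives `√O_j(Y) ≤ √O_j(K) ≤ o`. [folklore] -/
theorem sqrt_offCone_le_of_le {a : ℕ → UnitAddTorus (Fin 2) → ℝ} (has : ∀ j, IsSmooth (a j)) (j : ℕ) {K Y : ℕ} (hKY : K ≤ Y)
    {o : ℝ} (ho : Real.sqrt (∑' k : Fin 2 → ℤ, (if ((K : ℕ) : ℤ) ≤ |k 0| ∧ (((1 : ℕ)) : ℤ) * |k 0| ≤ (((4 : ℕ)) : ℤ) * |k 1| then (1 : ℝ) else 0) *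
      ‖mFourierCoeff (fun x => (a j x : ℂ)) k‖ ^ 2) ≤ o) :
    Real.sqrt (∑' k : Fin 2 → ℤ, (if ((Y : ℕ) : ℤ) ≤ |k 0| ∧ (((1 : ℕ)) : ℤ) * |k 0| ≤ (((4 : ℕ)) : ℤ) * |k 1| then (1 : ℝ) else 0) *
      ‖mFourierCoeff (fun x => (a j x : ℂ)) k‖ ^ 2) ≤ o := by
  refine (Real.sqrt_le_sqrt (tsum_indicator_le_of_imp (fun k hk => ⟨?_, hk.2⟩) (continuous_iterate_ofReal has j))).trans ho
  have h1 : ((K : ℕ) : ℤ) ≤ ((Y : ℕ) : ℤ) := by exact_mod_cast hKY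
  exact h1.trans hk.1

/-! ## §1 The four windows at phase 2 -/

set_option maxHeartbeats 4000000 in
/-- **(T-H) AT PHASE 2 AGAINST DECIMALS** (CT-GEO): `T_2(4400) ≤ S_2(800) + (W_T + √O_2(800))² + 10⁻⁸`, dyadic blocks from `Λ₀ = 800` (`ℓ = 400`, `r = 500`, `M_b = 17`, `ε_g = 1 / 50`, order `8`). [cite: Grafakos2014, Prop. 3.1.2 (5), Prop. 3.2.7 (3)] -/
theorem phase2_TH_ctg_le (hγ : P.γ = 8) (hδ₀ : 0 < P.δ₀) (hd : P.d = 2) (hN₀ : P.N₀ = 1) (hρN : P.ρN = 2)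
    (a b : ℕ → UnitAddTorus (Fin 2) → ℝ) (has : ∀ j, IsSmooth (a j)) (h0 : a 0 = datum)
    (hb : ∀ j, b j = a j ∘ shearMap 0 1 (amp ⟨P.U j, P.U_periodic j, P.contDiff_U (P.δ_pos hδ₀ (by rw [hd]; norm_num) j)⟩ P.γ))
    (hab : ∀ j, a (j + 1) = b j ∘ shearMap 1 0 (amp ⟨P.U j, P.U_periodic j, P.contDiff_U (P.δ_pos hδ₀ (by rw [hd]; norm_num) j)⟩ P.γ))
    (hδ₀' : P.δ₀ ≤ (2 : ℝ)⁻¹ ^ 100) :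
    ∑' k : Fin 2 → ℤ, (if |k 1| < ((4400 : ℕ) : ℤ) then (1 : ℝ) else 0) * ‖mFourierCoeff (fun x => (b 2 x : ℂ)) k‖ ^ 2 ≤
      ∑' k : Fin 2 → ℤ, (if |k 0| < ((800 : ℕ) : ℤ) then (1 : ℝ) else 0) * ‖mFourierCoeff (fun x => (a 2 x : ℂ)) k‖ ^ 2 +
      (((63631098 / 10 ^ 9 : ℝ) + (1504 / 10 ^ 15 : ℝ) + Real.sqrt (∑' k : Fin 2 → ℤ, (if ((800 : ℕ) : ℤ) ≤ |k 0| ∧ (((1 : ℕ)) : ℤ) * |k 0| ≤ (((4 : ℕ)) : ℤ) * |k 1| then (1 : ℝ) else 0) * ‖mFourierCoeff (fun x => (a 2 x : ℂ)) k‖ ^ 2)) ^ 2 + (1 / 10 ^ 4) ^ 2) := by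
  have hδ := P.delta_le_of_le hd hδ₀.le hδ₀' 2
  have hMδ : 10 * P.δ 2 < π / 2 := by
    have hπ := Real.pi_gt_three
    have h2 := hδ.2
    norm_num at h2
    linarith
  have hN : ((P.N 2 : ℕ) : ℝ) = 4 := by rw [K1Ledger.N_cast_eq P hN₀ hρN]; norm_num
  have h := lowFibre_hstep_ctg_le P hγ hδ₀ hd hN₀ hρN a b has h0 hb hab 2 4400 800 (by norm_num) 17 400 500 (by norm_num) (by norm_num) (by norm_num)
    (po := 8) (by norm_num) (εg := 1 / 50) (by norm_num) hMδ hδ.2 (u' := 1) (v' := 4) (by norm_num)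
    (A := (39099493 / 10 ^ 9 : ℝ)) (βs := (1723373 / 10 ^ 9 : ℝ)) (ρs := (5049 / 10 ^ 28 : ℝ)) (Z := (2354 / 10 ^ 31 : ℝ)) (by norm_num) (by norm_num)
    (by simp only [hN, Finset.sum_range_succ, Finset.sum_range_zero]; norm_num)
    (by intro m hm; simp only [hN]; simp only [Finset.mem_range] at hm; interval_cases m <;> norm_num)
    (by rw [hN]; norm_num) (by simp only [Finset.sum_range_succ, Finset.sum_range_zero]; norm_num)
  have hw : Real.sqrt ((39099493 / 10 ^ 9 : ℝ) / π ^ 2 + (1723373 / 10 ^ 9 : ℝ) / π ^ 2 / 2) + Real.sqrt ((5049 / 10 ^ 28 : ℝ) / 2 + (2354 / 10 ^ 31 : ℝ)) ≤ (63631098 / 10 ^ 9 : ℝ) + (1504 / 10 ^ 15 : ℝ) := by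
    refine sqrt_add_sqrt_le_of_sq ?_ ?_ (by norm_num) (by norm_num)
    · exact div_pi_sq_add_le (by norm_num) (by norm_num) (by norm_num)
    · norm_num
  have hf : ((1 + P.γ) ^ (2 * 2) / ((800 * 2 ^ 17 : ℕ) : ℝ)) ^ 2 ≤ (1 / 10 ^ 4) ^ 2 :=
    far_sq_le P hγ (t := 2) (X := 800 * 2 ^ 17) (by norm_num) (by norm_num)
  have hF := Real.sqrt_nonneg (∑' k : Fin 2 → ℤ, (if ((800 : ℕ) : ℤ) ≤ |k 0| ∧ (((1 : ℕ)) : ℤ) * |k 0| ≤ (((4 : ℕ)) : ℤ) * |k 1| then (1 : ℝ) else 0) * ‖mFourierCoeff (fun x => (a 2 x : ℂ)) k‖ ^ 2)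
  have hw0 : 0 ≤ Real.sqrt ((39099493 / 10 ^ 9 : ℝ) / π ^ 2 + (1723373 / 10 ^ 9 : ℝ) / π ^ 2 / 2) + Real.sqrt ((5049 / 10 ^ 28 : ℝ) / 2 + (2354 / 10 ^ 31 : ℝ)) := add_nonneg (Real.sqrt_nonneg _) (Real.sqrt_nonneg _)
  have hsq := pow_le_pow_left₀ (add_nonneg hw0 hF) (add_le_add hw (le_refl (Real.sqrt (∑' k : Fin 2 → ℤ, (if ((800 : ℕ) : ℤ) ≤ |k 0| ∧ (((1 : ℕ)) : ℤ) * |k 0| ≤ (((4 : ℕ)) : ℤ) * |k 1| then (1 : ℝ) else 0) * ‖mFourierCoeff (fun x => (a 2 x : ℂ)) k‖ ^ 2)))) 2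
  linarith

set_option maxHeartbeats 4000000 in
/-- **(S-V) AT PHASE 2 AGAINST DECIMALS** (CT-GEO): `S_3(24000) ≤ T_2(4400) + (W_S + √C_2(2001))² + 10⁻⁸`, dyadic blocks from `Λ₀ = 4400` (`ℓ = 2934`, `r = 2200`, `M_b = 21`, `ε_g = 1 / 20`). [cite: Grafakos2014, Prop. 3.1.2 (5), Prop. 3.2.7 (3)] -/
theorem phase2_SV_ctg_le (hγ : P.γ = 8) (hδ₀ : 0 < P.δ₀) (hd : P.d = 2) (hN₀ : P.N₀ = 1) (hρN : P.ρN = 2)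
    (a b : ℕ → UnitAddTorus (Fin 2) → ℝ) (has : ∀ j, IsSmooth (a j)) (h0 : a 0 = datum)
    (hb : ∀ j, b j = a j ∘ shearMap 0 1 (amp ⟨P.U j, P.U_periodic j, P.contDiff_U (P.δ_pos hδ₀ (by rw [hd]; norm_num) j)⟩ P.γ))
    (hab : ∀ j, a (j + 1) = b j ∘ shearMap 1 0 (amp ⟨P.U j, P.U_periodic j, P.contDiff_U (P.δ_pos hδ₀ (by rw [hd]; norm_num) j)⟩ P.γ))
    (hδ₀' : P.δ₀ ≤ (2 : ℝ)⁻¹ ^ 100) :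
    ∑' k : Fin 2 → ℤ, (if |k 0| < ((24000 : ℕ) : ℤ) then (1 : ℝ) else 0) * ‖mFourierCoeff (fun x => (a (2 + 1) x : ℂ)) k‖ ^ 2 ≤
      ∑' k : Fin 2 → ℤ, (if |k 1| < ((4400 : ℕ) : ℤ) then (1 : ℝ) else 0) * ‖mFourierCoeff (fun x => (b 2 x : ℂ)) k‖ ^ 2 +
      (((33040464 / 10 ^ 9 : ℝ) + (4526 / 10 ^ 14 : ℝ) + Real.sqrt (∑' k : Fin 2 → ℤ, (if ((2001 : ℕ) : ℤ) ≤ |k 0| ∧ (((1 : ℕ)) : ℤ) * |k 1| ≤ (((3 : ℕ)) : ℤ) * |k 0| then (1 : ℝ) else 0) * ‖mFourierCoeff (fun x => (b 2 x : ℂ)) k‖ ^ 2)) ^ 2 + (1 / 10 ^ 4) ^ 2) := by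
  have hδ := P.delta_le_of_le hd hδ₀.le hδ₀' 2
  have hMδ : 10 * P.δ 2 < π / 2 := by
    have hπ := Real.pi_gt_three
    have h2 := hδ.2
    norm_num at h2
    linarith
  have hN : ((P.N 2 : ℕ) : ℝ) = 4 := by rw [K1Ledger.N_cast_eq P hN₀ hρN]; norm_num
  have h := strip_vstep_ctg_le P hγ hδ₀ hd hN₀ hρN a b has h0 hb hab 2 24000 4400 (by norm_num) 21 2934 2200 (by norm_num) (by norm_num) (by norm_num)
    (po := 8) (by norm_num) (εg := 1 / 20) (by norm_num) hMδ hδ.2 (u' := 1) (v' := 3) (by norm_num) (Y := 2001) (by norm_num)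
    (A := (10275162 / 10 ^ 9 : ℝ)) (βs := (998408 / 10 ^ 9 : ℝ)) (ρs := (391 / 10 ^ 23 : ℝ)) (Z := (4101 / 10 ^ 31 : ℝ)) (by norm_num) (by norm_num)
    (by simp only [hN, Finset.sum_range_succ, Finset.sum_range_zero]; norm_num)
    (by intro m hm; simp only [hN]; simp only [Finset.mem_range] at hm; interval_cases m <;> norm_num)
    (by rw [hN]; norm_num) (by simp only [Finset.sum_range_succ, Finset.sum_range_zero]; norm_num)
  have hw : Real.sqrt ((10275162 / 10 ^ 9 : ℝ) / π ^ 2 + (998408 / 10 ^ 9 : ℝ) / π ^ 2 / 2) + Real.sqrt ((391 / 10 ^ 23 : ℝ) / 2 + (4101 / 10 ^ 31 : ℝ)) ≤ (33040464 / 10 ^ 9 : ℝ) + (4526 / 10 ^ 14 : ℝ) := by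
    refine sqrt_add_sqrt_le_of_sq ?_ ?_ (by norm_num) (by norm_num)
    · exact div_pi_sq_add_le (by norm_num) (by norm_num) (by norm_num)
    · norm_num
  have hf : ((1 + P.γ) ^ (2 * 3) / ((4400 * 2 ^ 21 : ℕ) : ℝ)) ^ 2 ≤ (1 / 10 ^ 4) ^ 2 :=
    far_sq_le P hγ (t := 3) (X := 4400 * 2 ^ 21) (by norm_num) (by norm_num)
  have hF := Real.sqrt_nonneg (∑' k : Fin 2 → ℤ, (if ((2001 : ℕ) : ℤ) ≤ |k 0| ∧ (((1 : ℕ)) : ℤ) * |k 1| ≤ (((3 : ℕ)) : ℤ) * |k 0| then (1 : ℝ) else 0) * ‖mFourierCoeff (fun x => (b 2 x : ℂ)) k‖ ^ 2)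
  have hw0 : 0 ≤ Real.sqrt ((10275162 / 10 ^ 9 : ℝ) / π ^ 2 + (998408 / 10 ^ 9 : ℝ) / π ^ 2 / 2) + Real.sqrt ((391 / 10 ^ 23 : ℝ) / 2 + (4101 / 10 ^ 31 : ℝ)) := add_nonneg (Real.sqrt_nonneg _) (Real.sqrt_nonneg _)
  have hsq := pow_le_pow_left₀ (add_nonneg hw0 hF) (add_le_add hw (le_refl (Real.sqrt (∑' k : Fin 2 → ℤ, (if ((2001 : ℕ) : ℤ) ≤ |k 0| ∧ (((1 : ℕ)) : ℤ) * |k 1| ≤ (((3 : ℕ)) : ℤ) * |k 0| then (1 : ℝ) else 0) * ‖mFourierCoeff (fun x => (b 2 x : ℂ)) k‖ ^ 2)))) 2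
  linarith

set_option maxHeartbeats 4000000 in
/-- **(O-V) AT PHASE 2 AGAINST DECIMALS** (CT-GEO): `O_3(24000) ≤ (W_O + √C_2(2001))² + 10⁻⁸`, blocks `⌊6000·(3/2)^m⌋`, support `⌊15Λ_m/16⌋`, plateau `⌊Λ_{m+1}/3⌋`, box window `4Λ_{m+1}` (`M_b = 34`, `ε_g = 1 / 20`). [cite: Grafakos2014, Prop. 3.1.2 (5), Prop. 3.2.7 (3)] -/
theorem phase2_OV_ctg_le (hγ : P.γ = 8) (hδ₀ : 0 < P.δ₀) (hd : P.d = 2) (hN₀ : P.N₀ = 1) (hρN : P.ρN = 2)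
    (a b : ℕ → UnitAddTorus (Fin 2) → ℝ) (has : ∀ j, IsSmooth (a j)) (h0 : a 0 = datum)
    (hb : ∀ j, b j = a j ∘ shearMap 0 1 (amp ⟨P.U j, P.U_periodic j, P.contDiff_U (P.δ_pos hδ₀ (by rw [hd]; norm_num) j)⟩ P.γ))
    (hab : ∀ j, a (j + 1) = b j ∘ shearMap 1 0 (amp ⟨P.U j, P.U_periodic j, P.contDiff_U (P.δ_pos hδ₀ (by rw [hd]; norm_num) j)⟩ P.γ))
    (hδ₀' : P.δ₀ ≤ (2 : ℝ)⁻¹ ^ 100) :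
    ∑' k : Fin 2 → ℤ, (if ((24000 : ℕ) : ℤ) ≤ |k 0| ∧ (((1 : ℕ)) : ℤ) * |k 0| ≤ (((4 : ℕ)) : ℤ) * |k 1| then (1 : ℝ) else 0) * ‖mFourierCoeff (fun x => (a (2 + 1) x : ℂ)) k‖ ^ 2 ≤
      ((49952058 / 10 ^ 9 : ℝ) + (2894 / 10 ^ 14 : ℝ) + Real.sqrt (∑' k : Fin 2 → ℤ, (if ((2001 : ℕ) : ℤ) ≤ |k 0| ∧ (((1 : ℕ)) : ℤ) * |k 1| ≤ (((3 : ℕ)) : ℤ) * |k 0| then (1 : ℝ) else 0) * ‖mFourierCoeff (fun x => (b 2 x : ℂ)) k‖ ^ 2)) ^ 2 + (1 / 10 ^ 4) ^ 2 := by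
  have hδ := P.delta_le_of_le hd hδ₀.le hδ₀' 2
  have hMδ : 10 * P.δ 2 < π / 2 := by
    have hπ := Real.pi_gt_three
    have h2 := hδ.2
    norm_num at h2
    linarith
  have hN : ((P.N 2 : ℕ) : ℝ) = 4 := by rw [K1Ledger.N_cast_eq P hN₀ hρN]; norm_num
  have h := ratio_vstep_ctg_le P hγ hδ₀ hd hN₀ hρN a b has h0 hb hab 2 (v := 4) (X := 24000) (by norm_num) (ra := 3) (rb := 2) (qn := 15) (qd := 16) 6000
    (by norm_num) (by norm_num) (by norm_num) 34 (by norm_num) (by norm_num) (u' := 1) (v' := 3) (by norm_num) (by norm_num)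
    (by norm_num) (by norm_num) (by norm_num) (by norm_num) (po := 8) (by norm_num) (εg := 1 / 20) (by norm_num) hMδ hδ.2 (Y := 2001) (by norm_num)
    (A := (23868154 / 10 ^ 9 : ℝ)) (βs := (15170934 / 10 ^ 10 : ℝ)) (ρs := (1558 / 10 ^ 24 : ℝ)) (Z := (5949 / 10 ^ 31 : ℝ)) (by norm_num) (by norm_num)
    (by simp only [hN, Finset.sum_range_succ, Finset.sum_range_zero]; norm_num)
    (by intro m hm; simp only [hN]; simp only [Finset.mem_range] at hm; interval_cases m <;> norm_num)
    (by rw [hN]; norm_num) (by simp only [Finset.sum_range_succ, Finset.sum_range_zero]; norm_num)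
  have hw : Real.sqrt ((23868154 / 10 ^ 9 : ℝ) / π ^ 2 + (15170934 / 10 ^ 10 : ℝ) / π ^ 2 / 2) + Real.sqrt ((1558 / 10 ^ 24 : ℝ) / 2 + (5949 / 10 ^ 31 : ℝ)) ≤ (49952058 / 10 ^ 9 : ℝ) + (2894 / 10 ^ 14 : ℝ) := by
    refine sqrt_add_sqrt_le_of_sq ?_ ?_ (by norm_num) (by norm_num)
    · exact div_pi_sq_add_le (by norm_num) (by norm_num) (by norm_num)
    · norm_num
  have hf : ((1 + P.γ) ^ (2 * 3) / ((6000 * 3 ^ 34 / 2 ^ 34 : ℕ) : ℝ)) ^ 2 ≤ (1 / 10 ^ 4) ^ 2 :=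
    far_sq_le P hγ (t := 3) (X := 6000 * 3 ^ 34 / 2 ^ 34) (by norm_num) (by norm_num)
  have hF := Real.sqrt_nonneg (∑' k : Fin 2 → ℤ, (if ((2001 : ℕ) : ℤ) ≤ |k 0| ∧ (((1 : ℕ)) : ℤ) * |k 1| ≤ (((3 : ℕ)) : ℤ) * |k 0| then (1 : ℝ) else 0) * ‖mFourierCoeff (fun x => (b 2 x : ℂ)) k‖ ^ 2)
  have hw0 : 0 ≤ Real.sqrt ((23868154 / 10 ^ 9 : ℝ) / π ^ 2 + (15170934 / 10 ^ 10 : ℝ) / π ^ 2 / 2) + Real.sqrt ((1558 / 10 ^ 24 : ℝ) / 2 + (5949 / 10 ^ 31 : ℝ)) := add_nonneg (Real.sqrt_nonneg _) (Real.sqrt_nonneg _)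
  have hsq := pow_le_pow_left₀ (add_nonneg hw0 hF) (add_le_add hw (le_refl (Real.sqrt (∑' k : Fin 2 → ℤ, (if ((2001 : ℕ) : ℤ) ≤ |k 0| ∧ (((1 : ℕ)) : ℤ) * |k 1| ≤ (((3 : ℕ)) : ℤ) * |k 0| then (1 : ℝ) else 0) * ‖mFourierCoeff (fun x => (b 2 x : ℂ)) k‖ ^ 2)))) 2
  linarith

set_option maxHeartbeats 4000000 in
/-- **(C-H) AT PHASE 2 AGAINST DECIMALS** (CT-GEO): `C_2(2001) ≤ (W_C + √O_2(2001))² + 10⁻⁸` — the feed cone is the OFF-CONE set above `Y ≥ K_2 = 800`, so its cap is `o_2` (no shell chain); blocks `⌊2001·(3/2)^m⌋`, support `⌊119Λ_m/96⌋`, plateau `⌊Λ_{m+1}/4⌋`, box window `3Λ_{m+1}` (`M_b = 26`, `ε_g = 1 / 20`). [cite: Grafakos2014, Prop. 3.1.2 (5), Prop. 3.2.7 (3)] -/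
theorem phase2_CH_ctg_le (hγ : P.γ = 8) (hδ₀ : 0 < P.δ₀) (hd : P.d = 2) (hN₀ : P.N₀ = 1) (hρN : P.ρN = 2)
    (a b : ℕ → UnitAddTorus (Fin 2) → ℝ) (has : ∀ j, IsSmooth (a j)) (h0 : a 0 = datum)
    (hb : ∀ j, b j = a j ∘ shearMap 0 1 (amp ⟨P.U j, P.U_periodic j, P.contDiff_U (P.δ_pos hδ₀ (by rw [hd]; norm_num) j)⟩ P.γ))
    (hab : ∀ j, a (j + 1) = b j ∘ shearMap 1 0 (amp ⟨P.U j, P.U_periodic j, P.contDiff_U (P.δ_pos hδ₀ (by rw [hd]; norm_num) j)⟩ P.γ))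
    (hδ₀' : P.δ₀ ≤ (2 : ℝ)⁻¹ ^ 100) :
    ∑' k : Fin 2 → ℤ, (if ((2001 : ℕ) : ℤ) ≤ |k 0| ∧ (((1 : ℕ)) : ℤ) * |k 1| ≤ (((3 : ℕ)) : ℤ) * |k 0| then (1 : ℝ) else 0) * ‖mFourierCoeff (fun x => (b 2 x : ℂ)) k‖ ^ 2 ≤
      ((41059393 / 10 ^ 9 : ℝ) + (1364 / 10 ^ 15 : ℝ) + Real.sqrt (∑' k : Fin 2 → ℤ, (if ((2001 : ℕ) : ℤ) ≤ |k 0| ∧ (((1 : ℕ)) : ℤ) * |k 0| ≤ (((4 : ℕ)) : ℤ) * |k 1| then (1 : ℝ) else 0) * ‖mFourierCoeff (fun x => (a 2 x : ℂ)) k‖ ^ 2)) ^ 2 + (1 / 10 ^ 4) ^ 2 := by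
  have hδ := P.delta_le_of_le hd hδ₀.le hδ₀' 2
  have hMδ : 10 * P.δ 2 < π / 2 := by
    have hπ := Real.pi_gt_three
    have h2 := hδ.2
    norm_num at h2
    linarith
  have hN : ((P.N 2 : ℕ) : ℝ) = 4 := by rw [K1Ledger.N_cast_eq P hN₀ hρN]; norm_num
  have h := ratio_hstep_ctg_le P hγ hδ₀ hd hN₀ hρN a b has h0 hb hab 2 (v := 3) (by norm_num) (ra := 3) (rb := 2) (qn := 119) (qd := 96) 2001
    (by norm_num) (by norm_num) (by norm_num) 26 (by norm_num) (u' := 1) (v' := 4) (by norm_num) (by norm_num)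
    (by norm_num) (by norm_num) (by norm_num) (by norm_num) (po := 8) (by norm_num) (εg := 1 / 20) (by norm_num) hMδ hδ.2 (Y := 2001) le_rfl
    (A := (16634524 / 10 ^ 9 : ℝ)) (βs := (87431673 / 10 ^ 13 : ℝ)) (ρs := (2638 / 10 ^ 28 : ℝ)) (Z := (2586 / 10 ^ 31 : ℝ)) (by norm_num) (by norm_num)
    (by simp only [hN, Finset.sum_range_succ, Finset.sum_range_zero]; norm_num)
    (by intro m hm; simp only [hN]; simp only [Finset.mem_range] at hm; interval_cases m <;> norm_num)
    (by rw [hN]; norm_num) (by simp only [Finset.sum_range_succ, Finset.sum_range_zero]; norm_num)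
  have hw : Real.sqrt ((16634524 / 10 ^ 9 : ℝ) / π ^ 2 + (87431673 / 10 ^ 13 : ℝ) / π ^ 2 / 2) + Real.sqrt ((2638 / 10 ^ 28 : ℝ) / 2 + (2586 / 10 ^ 31 : ℝ)) ≤ (41059393 / 10 ^ 9 : ℝ) + (1364 / 10 ^ 15 : ℝ) := by
    refine sqrt_add_sqrt_le_of_sq ?_ ?_ (by norm_num) (by norm_num)
    · exact div_pi_sq_add_le (by norm_num) (by norm_num) (by norm_num)
    · norm_num
  have hf : ((1 + P.γ) ^ (2 * 2) / ((2001 * 3 ^ 26 / 2 ^ 26 : ℕ) : ℝ)) ^ 2 ≤ (1 / 10 ^ 4) ^ 2 :=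
    far_sq_le P hγ (t := 2) (X := 2001 * 3 ^ 26 / 2 ^ 26) (by norm_num) (by norm_num)
  have hF := Real.sqrt_nonneg (∑' k : Fin 2 → ℤ, (if ((2001 : ℕ) : ℤ) ≤ |k 0| ∧ (((1 : ℕ)) : ℤ) * |k 0| ≤ (((4 : ℕ)) : ℤ) * |k 1| then (1 : ℝ) else 0) * ‖mFourierCoeff (fun x => (a 2 x : ℂ)) k‖ ^ 2)
  have hw0 : 0 ≤ Real.sqrt ((16634524 / 10 ^ 9 : ℝ) / π ^ 2 + (87431673 / 10 ^ 13 : ℝ) / π ^ 2 / 2) + Real.sqrt ((2638 / 10 ^ 28 : ℝ) / 2 + (2586 / 10 ^ 31 : ℝ)) := add_nonneg (Real.sqrt_nonneg _) (Real.sqrt_nonneg _)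
  have hsq := pow_le_pow_left₀ (add_nonneg hw0 hF) (add_le_add hw (le_refl (Real.sqrt (∑' k : Fin 2 → ℤ, (if ((2001 : ℕ) : ℤ) ≤ |k 0| ∧ (((1 : ℕ)) : ℤ) * |k 0| ≤ (((4 : ℕ)) : ℤ) * |k 1| then (1 : ℝ) else 0) * ‖mFourierCoeff (fun x => (a 2 x : ℂ)) k‖ ^ 2)))) 2
  linarith

/-! ## §2 The phase-2 step and the next off-cone amplitude -/

set_option maxHeartbeats 800000 in
/-- **PHASE 2 OF THE K1loc′ LEDGER IN CT-GEO GRADE, AGAINST DECIMALS** (`…LedgerFeedChain.strip_offCone_resolved_step` on the four windows above, both feed caps `= o ≥ √O_2(800)` by `sqrt_offCone_le_of_le`): `S_3(24000) + O_3(24000) ≤ S_2(800) + O_2(800) + e_2(o)`. [cite: Grafakos2014, Prop. 3.1.2 (5), Prop. 3.2.7 (3)] -/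
theorem phase2_step_ctg_le (hγ : P.γ = 8) (hδ₀ : 0 < P.δ₀) (hd : P.d = 2) (hN₀ : P.N₀ = 1) (hρN : P.ρN = 2)
    (a b : ℕ → UnitAddTorus (Fin 2) → ℝ) (has : ∀ j, IsSmooth (a j)) (h0 : a 0 = datum)
    (hb : ∀ j, b j = a j ∘ shearMap 0 1 (amp ⟨P.U j, P.U_periodic j, P.contDiff_U (P.δ_pos hδ₀ (by rw [hd]; norm_num) j)⟩ P.γ))
    (hab : ∀ j, a (j + 1) = b j ∘ shearMap 1 0 (amp ⟨P.U j, P.U_periodic j, P.contDiff_U (P.δ_pos hδ₀ (by rw [hd]; norm_num) j)⟩ P.γ))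
    (hδ₀' : P.δ₀ ≤ (2 : ℝ)⁻¹ ^ 100)
    {o : ℝ} (ho : Real.sqrt (∑' k : Fin 2 → ℤ, (if ((800 : ℕ) : ℤ) ≤ |k 0| ∧ (((1 : ℕ)) : ℤ) * |k 0| ≤ (((4 : ℕ)) : ℤ) * |k 1| then (1 : ℝ) else 0) * ‖mFourierCoeff (fun x => (a 2 x : ℂ)) k‖ ^ 2) ≤ o) :
    ∑' k : Fin 2 → ℤ, (if |k 0| < ((24000 : ℕ) : ℤ) then (1 : ℝ) else 0) * ‖mFourierCoeff (fun x => (a (2 + 1) x : ℂ)) k‖ ^ 2 +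
      ∑' k : Fin 2 → ℤ, (if ((24000 : ℕ) : ℤ) ≤ |k 0| ∧ (((1 : ℕ)) : ℤ) * |k 0| ≤ (((4 : ℕ)) : ℤ) * |k 1| then (1 : ℝ) else 0) * ‖mFourierCoeff (fun x => (a (2 + 1) x : ℂ)) k‖ ^ 2 ≤
      ∑' k : Fin 2 → ℤ, (if |k 0| < ((800 : ℕ) : ℤ) then (1 : ℝ) else 0) * ‖mFourierCoeff (fun x => (a 2 x : ℂ)) k‖ ^ 2 +
      ∑' k : Fin 2 → ℤ, (if ((800 : ℕ) : ℤ) ≤ |k 0| ∧ (((1 : ℕ)) : ℤ) * |k 0| ≤ (((4 : ℕ)) : ℤ) * |k 1| then (1 : ℝ) else 0) * ‖mFourierCoeff (fun x => (a 2 x : ℂ)) k‖ ^ 2 +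
      (((63631098 / 10 ^ 9 : ℝ) + (1504 / 10 ^ 15 : ℝ)) ^ 2 + 2 * ((63631098 / 10 ^ 9 : ℝ) + (1504 / 10 ^ 15 : ℝ)) * o + (((33040464 / 10 ^ 9 : ℝ) + (4526 / 10 ^ 14 : ℝ)) + ((41059393 / 10 ^ 9 : ℝ) + (1364 / 10 ^ 15 : ℝ)) + o + 1 / 10 ^ 4) ^ 2 + (((49952058 / 10 ^ 9 : ℝ) + (2894 / 10 ^ 14 : ℝ)) + ((41059393 / 10 ^ 9 : ℝ) + (1364 / 10 ^ 15 : ℝ)) + o + 1 / 10 ^ 4) ^ 2 +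
        (1 / 10 ^ 4) ^ 2 + (1 / 10 ^ 4) ^ 2 + (1 / 10 ^ 4) ^ 2) := by
  have h1 := phase2_SV_ctg_le P hγ hδ₀ hd hN₀ hρN a b has h0 hb hab hδ₀'
  have h2 := phase2_TH_ctg_le P hγ hδ₀ hd hN₀ hρN a b has h0 hb hab hδ₀'
  have h3 := phase2_OV_ctg_le P hγ hδ₀ hd hN₀ hρN a b has h0 hb hab hδ₀'
  have h4 := phase2_CH_ctg_le P hγ hδ₀ hd hN₀ hρN a b has h0 hb hab hδ₀'
  have h𝔞 := sqrt_offCone_le_of_le has 2 (K := 800) (Y := 2001) (by norm_num) ho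
  have hI0 : ∀ (q : (Fin 2 → ℤ) → Prop) [DecidablePred q] (v : UnitAddTorus (Fin 2) → ℝ),
      0 ≤ ∑' k : Fin 2 → ℤ, (if q k then (1 : ℝ) else 0) * ‖mFourierCoeff (fun x => (v x : ℂ)) k‖ ^ 2 :=
    fun q _ v => tsum_nonneg fun k => mul_nonneg (by split_ifs <;> norm_num) (sq_nonneg _)
  have h1' := h1.trans (add_assoc _ _ _).symm.le
  have h2' := h2.trans (add_assoc _ _ _).symm.le
  have hres := strip_offCone_resolved_step h1' h2' h3 h4 h4 h𝔞 h𝔞 ho (hI0 _ _) (hI0 _ _) (hI0 _ _) (by norm_num) (by norm_num)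
    (by norm_num) (by norm_num) (by norm_num) (by norm_num) (by norm_num)
  rw [Real.sqrt_sq (by norm_num : (0 : ℝ) ≤ 1 / 10 ^ 4)] at hres
  exact hres

set_option maxHeartbeats 800000 in
/-- **THE NEXT OFF-CONE AMPLITUDE AT PHASE 2** (`…LedgerFeedChain.sqrt_offCone_next_le`): `√O_3(24000) ≤ W_O + W_C + o + 2·10⁻⁴`. [cite: Grafakos2014, Prop. 3.2.7 (3)] -/
theorem phase2_offCone_next_ctg_le (hγ : P.γ = 8) (hδ₀ : 0 < P.δ₀) (hd : P.d = 2) (hN₀ : P.N₀ = 1) (hρN : P.ρN = 2)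
    (a b : ℕ → UnitAddTorus (Fin 2) → ℝ) (has : ∀ j, IsSmooth (a j)) (h0 : a 0 = datum)
    (hb : ∀ j, b j = a j ∘ shearMap 0 1 (amp ⟨P.U j, P.U_periodic j, P.contDiff_U (P.δ_pos hδ₀ (by rw [hd]; norm_num) j)⟩ P.γ))
    (hab : ∀ j, a (j + 1) = b j ∘ shearMap 1 0 (amp ⟨P.U j, P.U_periodic j, P.contDiff_U (P.δ_pos hδ₀ (by rw [hd]; norm_num) j)⟩ P.γ))
    (hδ₀' : P.δ₀ ≤ (2 : ℝ)⁻¹ ^ 100)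
    {o : ℝ} (ho : Real.sqrt (∑' k : Fin 2 → ℤ, (if ((800 : ℕ) : ℤ) ≤ |k 0| ∧ (((1 : ℕ)) : ℤ) * |k 0| ≤ (((4 : ℕ)) : ℤ) * |k 1| then (1 : ℝ) else 0) * ‖mFourierCoeff (fun x => (a 2 x : ℂ)) k‖ ^ 2) ≤ o) :
    Real.sqrt (∑' k : Fin 2 → ℤ, (if ((24000 : ℕ) : ℤ) ≤ |k 0| ∧ (((1 : ℕ)) : ℤ) * |k 0| ≤ (((4 : ℕ)) : ℤ) * |k 1| then (1 : ℝ) else 0) * ‖mFourierCoeff (fun x => (a (2 + 1) x : ℂ)) k‖ ^ 2) ≤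
      ((49952058 / 10 ^ 9 : ℝ) + (2894 / 10 ^ 14 : ℝ)) + ((41059393 / 10 ^ 9 : ℝ) + (1364 / 10 ^ 15 : ℝ)) + o + 1 / 10 ^ 4 + 1 / 10 ^ 4 := by
  have h3 := phase2_OV_ctg_le P hγ hδ₀ hd hN₀ hρN a b has h0 hb hab hδ₀'
  have h5 := phase2_CH_ctg_le P hγ hδ₀ hd hN₀ hρN a b has h0 hb hab hδ₀'
  have h𝔞 := sqrt_offCone_le_of_le has 2 (K := 800) (Y := 2001) (by norm_num) ho
  have hI0 : ∀ (q : (Fin 2 → ℤ) → Prop) [DecidablePred q] (v : UnitAddTorus (Fin 2) → ℝ),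
      0 ≤ ∑' k : Fin 2 → ℤ, (if q k then (1 : ℝ) else 0) * ‖mFourierCoeff (fun x => (v x : ℂ)) k‖ ^ 2 :=
    fun q _ v => tsum_nonneg fun k => mul_nonneg (by split_ifs <;> norm_num) (sq_nonneg _)
  have hres := sqrt_offCone_next_le h3 h5 h𝔞 (hI0 _ _) (by norm_num) (by norm_num) (by norm_num) (by norm_num)
  rw [Real.sqrt_sq (by norm_num : (0 : ℝ) ≤ 1 / 10 ^ 4)] at hres
  exact hres

end Cascade

end Summit.AnomalousDissipation.AnomalousDissipation.Theorems.SawtoothPulseCascade.K1Window
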